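import Literature.MathematicalPhysics.QuantumFieldTheory.Balaban1983to89.B7Prop2SpecialUnitary

/-!
# `Balaban1983to89.B7Eq50Linear` — T. Bałaban, *Averaging operations for lattice gauge theories*, Commun. Math.
# Phys. **98** (1985) 17–51 [Balaban1985Averaging]: the estimate (50) p. 25 in its printed LINEAR form
# `|V̄(∂p′) − 1| < Σ_{x∈B(y₀)} L^{−d} Σ_{p⊂(p′)_x} |V(∂p) − 1| + O(1)(L²α₀)²`, PROVED for the concrete one-step average
# (42) on `ℤ^d` with the explicit `O(1) = C₀(d) = 14464(d+1)²(d+4)²` of `B7Prop1Explicit`; and (53)/(54) p. 26 at an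
# intermediate level `i ≤ k` for the concrete `k`-fold average (43)

statement-level skeleton of published theorems with citation tags; proofs where landed; nothing here is a claim
about the Yang–Mills mass gap

PDF held: `paper:balaban1985-cmp98-averaging` (journal page = PDF page + 16); pp. 24–26 (PDF 8–10), the printed text
quoted verbatim in the header of `B7Prop1Explicit` (page renders `…/1985-cmp98-averaging-p008…p010-x2.png` read there).

WHAT IS REPRODUCED.  SKELETON row `B7.Eq45` ((45)–(50) p. 24–25, «proved-existing @gen»; mega-formalization
`lit-balaban`, HOME `run/shared/lean/pub/lit-balaban/`) — the display (50), FIRST INEQUALITY, with its sum kept.  THE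
PRINTED TEXT (p. 25): *"Gathering together the above three inequalities, we obtain `|V̄₀(∂p′) − 1| < Σ_{x∈B(y₀)} L^{−d}
Σ_{p⊂(p′)_x} |A(∂p)| + O(1)(L²α₀)² < Σ_{x∈B(y₀)} L^{−d} Σ_{p⊂(p′)_x} |V₀(∂p) − 1| + O(1)(L²α₀)² < L²α₀ + O(1)(L²α₀)²`.
(50)"*, where (p. 25) *"`(p′)_x` [is] a plaquette obtained by translation of the plaquette `p′` to the point `x`"* and
(45) p. 24 *"`|V₀(∂p) − 1| = |V(∂p) − 1| < α₀`, `|V̄(∂p′) − 1| = |V̄₀(∂p′) − 1|`"* (`V₀ = V^{v₀}` the axial gauge at the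
upper right corner `y` of `p′`).  The tree certifies (50) only in its already-summed form — the kept sum replaced at once
by `L²α₀`, i.e. Proposition 1 (51) (`B7Prop1Explicit.main_term_bound`, `.prop1_core`, `.prop1_explicit`).  B10 =
[Balaban1985UV3] p. 273 *"Applying the inequalities (50), (53) [4], we have (69)"* consumes (50) with the sum KEPT
(companion file `B10Eq69Concrete`, same seat); this file supplies it:
* `prop1_linear` — for `V : ℤ^d → {u : |u| ≤ 1, |u⁻¹| ≤ 1}` with (44) `sup_p |V(∂p) − 1| ≤ α₀`, `512(d+1)(d+4)L²α₀ ≤ 1`: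
  `|V̄(∂p′) − 1| ≤ Σ_{x∈B(y₀)} L^{−d} Σ_{p⊂(p′)_x} |V(∂p) − 1| + C₀(L²α₀)²` (`blockFineAvg` = the kept sum);
* `prop1_core_linear` — the same in the axial gauge (hypothesis: the bond bound `|V₀,b − 1| ≤ |b₋ − y|₁α₀` of p. 25
  only), `main_term_linear` — (49) in kept-sum form; the proof is that of `B7Prop1Explicit.prop1_core` verbatim
  ((47): `side_estimate`, `norm_prod4_sub_one_sub_le`; (48): `corner_cancellation`, `stokes`; (49): `walk_linear`),
  only the last step "`< L²α₀ + …`" is not taken; `fineSum_gaugeAct_le` — (45) for the kept sum (`≤`, conjugation);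
* `pdev_avgIter_lt_level` — (53)/(54) p. 26 at an intermediate level: under (52) `sup |U(∂p) − 1| < α₀η²`,
  `η = L^{−k}`, every `Ū^i`, `i ≤ k`, has `sup |Ū^i(∂p) − 1| < 2α₀(L^iη)²` (Prop. 2 = `B7Prop2SpecialUnitary.
  prop2_explicit_at_lt_two` applied with `k := i` and the constant `α₀(L^iη)² ≤ α₀`) — the form in which B10 (69) uses
  "(53)".
MODEL NOTES.  (M1) Carriers = those of `B7Prop1Explicit` / `B7Prop2Explicit` / `B7Prop2SpecialUnitary` by name (every
lattice `Ω^{(j)} ≅ ℤ^d`, words, `hol`, `bavg`, `cplaq`, `avgIter`, `pdev`, `U1 𝔸`, `AvgClosedAt`); nothing re-declared.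
(M2) (44)/(52) are assumed on all of `ℤ^d` (the printed locality "`p ⊂ Δ(p′)`" is not certified — DIVERGENCE (a) of
`B7Prop1Explicit`, inherited).  (M3) `≤` for the printed strict `<` in (50) (hypothesis (44) with `≤`), as in
`prop1_explicit`.  (M4) Constants = the admissible witnesses `C₀ = 226·(8(d+1)(d+4))²`, `c₂′ = 1/(512(d+1)(d+4)L²)` of
`B7Prop1Explicit`; the `O(1)(L²α₀)²` of (50) is `226θ²`, `θ = 8(d+1)(d+4)L²α₀`, exactly as in (51) there.
Unit `lit-balaban-p29` (Phase-2 proof seat p29, gen 4); HOME `run/shared/lean/pub/lit-balaban/`.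
-/

noncomputable section

open scoped BigOperators
open NormedSpace Finset

namespace Literature.MathematicalPhysics.QuantumFieldTheory.Balaban1983to89.B7Eq50Linear

open B7Prop1Explicit B7Prop2Explicit B7Prop2SpecialUnitary MatrixLog

-- `Site` alone could resolve to the torus sites of `Setup.lean` through a parent namespace; re-export the `ℤ^d`
-- sites `Fin d → ℤ` of `B7Prop1Explicit`.
export B7Prop1Explicit (Site)

variable {d : ℕ}

/-! ## §1 The kept sum of (50): fine plaquettes of a translated big plaquette, and its block average -/

section Sums

variable {𝔸 : Type*} [NormedRing 𝔸]

/-- `Σ_{p ⊂ (p′)_x} |V(∂p) − 1|` — the sum of the plaquette deviations of `V` over the `n²` unit plaquettes `p`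
tiling the `n × n` square `(p′)_x` with lower-left corner `x` spanned by `e_μ, e_ν` (B7 (48)/(50) with `n = L`:
"`(p′)_x` a plaquette obtained by translation of the plaquette `p′` to the point `x`"; B10 (69) with `n = L^j`:
"`(p′)_x` denotes the plaquette `p′` transported parallelly to the point `x`, i.e. the lower left corner coincides
with the point `x`"). [cite: Balaban1985UV3, (69) p.273; Balaban1985Averaging, (48)–(50) p.25] -/
def fineSum (n : ℕ) (V : Site d → Fin d → 𝔸ˣ) (x : Site d) (μ ν : Fin d) : ℝ :=
  ∑ a ∈ Finset.range n, ∑ b ∈ Finset.range n,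
    ‖((hol V (x + (a : ℤ) • e μ + (b : ℤ) • e ν) (plaqWord μ ν) : 𝔸ˣ) : 𝔸) - 1‖

/-- `fineSum_nonneg`: the kept sum of (50) is a sum of norms, `≥ 0`. [cite: Balaban1985Averaging, (50) p.25] -/
theorem fineSum_nonneg (n : ℕ) (V : Site d → Fin d → 𝔸ˣ) (x : Site d) (μ ν : Fin d) :
    0 ≤ fineSum n V x μ ν :=
  Finset.sum_nonneg fun _ _ => Finset.sum_nonneg fun _ _ => norm_nonneg _

/-- The block-averaged fine sum of ONE averaging step, the first sum of B7 (50):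
`Σ_{x ∈ B(y₀)} L^{−d} Σ_{p ⊂ (p′)_x} |V(∂p) − 1|` for the `L`-plaquette `p′` with lower-left corner `y₀ = z`
(`x = z + r`, `r ∈ [0, L)^d`). [cite: Balaban1985Averaging, (50) p.25] -/
def blockFineAvg (L : ℕ) (V : Site d → Fin d → 𝔸ˣ) (z : Site d) (μ ν : Fin d) : ℝ :=
  ∑ r : Fin d → Fin L, ((L : ℝ) ^ d)⁻¹ * fineSum L V (z + boxVec L r) μ ν

/-- `blockFineAvg_nonneg`: the block-averaged kept sum of (50) is `≥ 0`. [cite: Balaban1985Averaging, (50) p.25] -/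
theorem blockFineAvg_nonneg (L : ℕ) (V : Site d → Fin d → 𝔸ˣ) (z : Site d) (μ ν : Fin d) :
    0 ≤ blockFineAvg L V z μ ν :=
  Finset.sum_nonneg fun _ _ => mul_nonneg (by positivity) (fineSum_nonneg _ _ _ _ _)

end Sums

/-! ## §2 B7 (50) in its printed LINEAR form, for the concrete one-step average (42) on `ℤ^d`

`B7Prop1Explicit` certifies Proposition 1 (51) `|V̄(∂p′) − 1| ≤ L²α₀ + C₀(L²α₀)²`, i.e. (50) with its first sum
`Σ_{x∈B(y₀)} L^{−d} Σ_{p⊂(p′)_x} |V₀(∂p) − 1|` already bounded by `L²α₀`.  B10 (69) applies (50) with the sum KEPT;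
this section re-assembles the printed steps (47)–(49) of `B7Prop1Explicit` (`side_estimate`, `norm_prod4_sub_one_sub_le`,
`corner_cancellation`, `stokes`, `walk_linear`) into that linear form. -/

section Linear

variable {𝔸 : Type*} [NormedRing 𝔸] [NormOneClass 𝔸] [NormedAlgebra ℂ 𝔸] [CompleteSpace 𝔸]

omit [NormOneClass 𝔸] in
/-- **(49)–(50), main term with the sum kept:** in the gauge `V₀ = exp A`, `|A_b| ≤ a` near `y`,
`|Σ_x L^{−d} A(∂(p′)_x)| ≤ Σ_x L^{−d} Σ_{p⊂(p′)_x} |A(∂p)| ≤ Σ_x L^{−d} Σ_{p⊂(p′)_x} |V₀(∂p) − 1| + L²ρ(4a)`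
(per plaquette `|A(∂p)| ≤ |V₀(∂p) − 1| + ρ(4a)`, `walk_linear`; print: "`|V₀(∂p) − 1 − iA(∂p)| < ½(|A|(∂p))²`" (49)).
[cite: Balaban1985Averaging, (49)–(50) p.25] -/
theorem main_term_linear (V₀ : Site d → Fin d → 𝔸ˣ) (A : Site d → Fin d → 𝔸) (y : Site d) (R : ℕ) {a : ℝ}
    (ha : 0 ≤ a) (hVA : ∀ x κ, l1 (x - y) ≤ R → ((V₀ x κ : 𝔸ˣ) : 𝔸) = exp (A x κ) ∧ ‖A x κ‖ ≤ a)
    (L : ℕ) (hL : 1 ≤ L) (z : Site d) (μ ν : Fin d)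
    (hR : ∀ (r : Fin d → Fin L) (i j : ℕ), i < L → j < L →
      l1 (z + boxVec L r + (i : ℤ) • e μ + (j : ℤ) • e ν - y) + 4 ≤ R) :
    ‖∑ r : Fin d → Fin L, ((L : ℝ) ^ d)⁻¹ • asum A (z + boxVec L r) (rectWord L L μ ν)‖
      ≤ blockFineAvg L V₀ z μ ν + L ^ 2 * expRem (4 * a) := by
  have hw0 : (0 : ℝ) ≤ ((L : ℝ) ^ d)⁻¹ := by positivity
  have hp : ∀ (r : Fin d → Fin L), ∀ i ∈ Finset.range L, ∀ j ∈ Finset.range L,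
      ‖asum A (z + boxVec L r + (i : ℤ) • e μ + (j : ℤ) • e ν) (plaqWord μ ν)‖
        ≤ ‖((hol V₀ (z + boxVec L r + (i : ℤ) • e μ + (j : ℤ) • e ν) (plaqWord μ ν) : 𝔸ˣ) : 𝔸) - 1‖
          + expRem (4 * a) := by
    intro r i hi j hj
    rw [Finset.mem_range] at hi hj
    obtain ⟨_, h2⟩ := walk_linear V₀ A y R ha hVA (plaqWord μ ν) _ (hR r i j hi hj)
    have hl : ((plaqWord μ ν).length : ℝ) = 4 := by simp [plaqWord]
    rw [hl] at h2
    set H : 𝔸 := ((hol V₀ (z + boxVec L r + (i : ℤ) • e μ + (j : ℤ) • e ν) (plaqWord μ ν) : 𝔸ˣ) : 𝔸) - 1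
    have : asum A (z + boxVec L r + (i : ℤ) • e μ + (j : ℤ) • e ν) (plaqWord μ ν)
        = H - (H - asum A (z + boxVec L r + (i : ℤ) • e μ + (j : ℤ) • e ν) (plaqWord μ ν)) := by abel
    rw [this]
    exact (norm_sub_le _ _).trans (add_le_add le_rfl h2)
  have hblock : ∀ r : Fin d → Fin L, ‖asum A (z + boxVec L r) (rectWord L L μ ν)‖
      ≤ fineSum L V₀ (z + boxVec L r) μ ν + L ^ 2 * expRem (4 * a) := by
    intro r
    rw [stokes]
    calc _ ≤ ∑ i ∈ Finset.range L, ‖∑ j ∈ Finset.range L,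
            asum A (z + boxVec L r + (i : ℤ) • e μ + (j : ℤ) • e ν) (plaqWord μ ν)‖ := norm_sum_le _ _
      _ ≤ ∑ i ∈ Finset.range L, ∑ j ∈ Finset.range L,
            ‖asum A (z + boxVec L r + (i : ℤ) • e μ + (j : ℤ) • e ν) (plaqWord μ ν)‖ :=
          Finset.sum_le_sum fun i _ => norm_sum_le _ _
      _ ≤ ∑ i ∈ Finset.range L, ∑ j ∈ Finset.range L,
            (‖((hol V₀ (z + boxVec L r + (i : ℤ) • e μ + (j : ℤ) • e ν) (plaqWord μ ν) : 𝔸ˣ) : 𝔸) - 1‖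
              + expRem (4 * a)) :=
          Finset.sum_le_sum fun i hi => Finset.sum_le_sum fun j hj => hp r i hi j hj
      _ = fineSum L V₀ (z + boxVec L r) μ ν + L ^ 2 * expRem (4 * a) := by
          rw [Finset.sum_congr rfl fun i _ => Finset.sum_add_distrib, Finset.sum_add_distrib]
          unfold fineSum
          congr 1
          rw [Finset.sum_const, Finset.sum_const, Finset.card_range, nsmul_eq_mul, nsmul_eq_mul]; ring
  calc _ ≤ ∑ r : Fin d → Fin L, ‖((L : ℝ) ^ d)⁻¹ • asum A (z + boxVec L r) (rectWord L L μ ν)‖ := norm_sum_le _ _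
    _ ≤ ∑ r : Fin d → Fin L, ((L : ℝ) ^ d)⁻¹ * (fineSum L V₀ (z + boxVec L r) μ ν + L ^ 2 * expRem (4 * a)) :=
        Finset.sum_le_sum fun r _ => by
          rw [norm_smul, Real.norm_of_nonneg hw0]
          exact mul_le_mul_of_nonneg_left (hblock r) hw0
    _ = blockFineAvg L V₀ z μ ν + L ^ 2 * expRem (4 * a) := by
        simp only [mul_add, Finset.sum_add_distrib, blockFineAvg, ← Finset.sum_mul, sum_weights L hL, one_mul]

omit [NormOneClass 𝔸] in
/-- **(50) in the axial gauge, linear form (pp. 24–26):** for a configuration `V₀` whose bond variables within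
`l¹`-distance `(2d+4)L + 4` of `y = y₀ + Le_μ + Le_ν` satisfy `|V₀(b) − 1| ≤ |b₋ − y|₁ · α₀` (the axial-gauge bound of
p. 25; no separate plaquette hypothesis (44) is needed for the kept-sum form), with `θ := 8(d+1)(d+4)L²α₀ ≤ 1/64`:
`|V̄₀(∂p′) − 1| ≤ Σ_{x∈B(y₀)} L^{−d} Σ_{p⊂(p′)_x} |V₀(∂p) − 1| + 226 θ²` — the first inequality of (50), where print
continues "`< L²α₀ + O(1)(L²α₀)²`" (that continuation is `B7Prop1Explicit.prop1_core`).  Proof = the proof of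
`prop1_core` verbatim ((47) four sides `side_estimate` + `norm_prod4_sub_one_sub_le`, (48) `corner_cancellation` +
`stokes`) with (49) in the kept-sum form `main_term_linear`. [cite: Balaban1985Averaging, (50) p.25] -/
theorem prop1_core_linear (L : ℕ) (hL : 1 ≤ L) (z y : Site d) {μ ν : Fin d}
    (hy : y = z + (L : ℤ) • e μ + (L : ℤ) • e ν) (V₀ : Site d → Fin d → 𝔸ˣ) {α₀ : ℝ} (hα₀ : 0 ≤ α₀)
    (hsmall : 512 * (d + 1) * (d + 4) * (L : ℝ) ^ 2 * α₀ ≤ 1)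
    (hbond : ∀ x κ, l1 (x - y) ≤ (2 * d + 4) * L + 4 → ‖((V₀ x κ : 𝔸ˣ) : 𝔸) - 1‖ ≤ l1 (x - y) * α₀) :
    ‖((cplaq L (bavg L V₀) z μ ν : 𝔸ˣ) : 𝔸) - 1‖
        ≤ blockFineAvg L V₀ z μ ν + 226 * (8 * (d + 1) * (d + 4) * (L : ℝ) ^ 2 * α₀) ^ 2 := by
  have hd : 1 ≤ d := μ.pos
  -- the constants (as in `B7Prop1Explicit.prop1_core`)
  set R : ℕ := (2 * d + 4) * L + 4 with hRdef
  set a : ℝ := 4 * (d + 4) * L * α₀ with hadef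
  set θ : ℝ := 8 * (d + 1) * (d + 4) * (L : ℝ) ^ 2 * α₀ with hθdef
  have hLr : (1 : ℝ) ≤ L := by exact_mod_cast hL
  have hdr : (1 : ℝ) ≤ d := by exact_mod_cast hd
  have ha : 0 ≤ a := by positivity
  have hθ0 : 0 ≤ θ := by positivity
  have hθ1 : θ ≤ 1 / 64 := by
    have : 64 * θ = 512 * (d + 1) * (d + 4) * (L : ℝ) ^ 2 * α₀ := by rw [hθdef]; ring
    linarith
  have haθ : 4 * a ≤ θ := by
    have e1 : θ - 4 * a = 8 * ((d : ℝ) + 4) * L * α₀ * ((d + 1) * L - 2) := by rw [hθdef, hadef]; ring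
    have e2 : 0 ≤ 8 * ((d : ℝ) + 4) * L * α₀ * ((d + 1) * L - 2) :=
      mul_nonneg (by positivity) (by nlinarith [mul_nonneg (sub_nonneg.mpr hdr) (by positivity : (0 : ℝ) ≤ L)])
    linarith
  have ha1 : a ≤ 1 := by linarith
  have hRa : ((R : ℕ) : ℝ) * α₀ ≤ a / 2 := by
    have e1 : a / 2 - ((R : ℕ) : ℝ) * α₀ = 4 * ((L : ℝ) - 1) * α₀ := by rw [hRdef, hadef]; push_cast; ring
    have e2 : 0 ≤ 4 * ((L : ℝ) - 1) * α₀ := mul_nonneg (mul_nonneg (by norm_num) (by linarith)) hα₀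
    linarith
  -- the bond field `A = log V₀` (p. 25)
  have hb : ∀ x κ, l1 (x - y) ≤ R → ‖((V₀ x κ : 𝔸ˣ) : 𝔸) - 1‖ ≤ a / 2 := fun x κ hx =>
    (hbond x κ hx).trans ((mul_le_mul_of_nonneg_right (by exact_mod_cast hx) hα₀).trans hRa)
  have hVA := bond_log y R ha1 hb
  set A : Site d → Fin d → 𝔸 := fun x κ => MatrixLog.mlog ((V₀ x κ : 𝔸ˣ) : 𝔸) with hAdef
  -- the four sides (47)
  have hθN : ((2 * (d * L) + L + L : ℕ) : ℝ) * a ≤ θ := le_of_eq (by rw [hadef, hθdef]; push_cast; ring)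
  have hRexp : R = 2 * (d * L) + 4 * L + 4 := by rw [hRdef]; ring
  have hzy : l1 (z - y) ≤ 2 * L := by
    rw [hy, show z - (z + (L : ℤ) • e μ + (L : ℤ) • e ν) = -((L : ℤ) • e μ + (L : ℤ) • e ν) by abel, l1_neg]
    refine (l1_add_le _ _).trans ?_
    rw [l1_zsmul_e, l1_zsmul_e, Int.natAbs_natCast]; omega
  have hzμy : l1 (z + (L : ℤ) • e μ - y) ≤ 2 * L := by
    rw [hy, show z + (L : ℤ) • e μ - (z + (L : ℤ) • e μ + (L : ℤ) • e ν) = -((L : ℤ) • e ν) by abel, l1_neg,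
      l1_zsmul_e, Int.natAbs_natCast]; omega
  have hzνy : l1 (z + (L : ℤ) • e ν - y) ≤ 2 * L := by
    rw [hy, show z + (L : ℤ) • e ν - (z + (L : ℤ) • e μ + (L : ℤ) • e ν) = -((L : ℤ) • e μ) by abel, l1_neg,
      l1_zsmul_e, Int.natAbs_natCast]; omega
  have hside : ∀ q κ, l1 (q - y) ≤ 2 * L →
      ‖((bavg L V₀ q κ : 𝔸ˣ) : 𝔸) - 1‖ ≤ 2 * θ ∧
      ‖((bavg L V₀ q κ : 𝔸ˣ) : 𝔸) - 1 - Tside L A q κ‖ ≤ 50 * θ ^ 2 ∧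
      ‖(((bavg L V₀ q κ)⁻¹ : 𝔸ˣ) : 𝔸) - 1‖ ≤ 2 * θ ∧
      ‖(((bavg L V₀ q κ)⁻¹ : 𝔸ˣ) : 𝔸) - 1 - (-Tside L A q κ)‖ ≤ 50 * θ ^ 2 ∧
      ∀ r : Fin d → Fin L, ‖((Wcx L V₀ q κ (boxVec L r) : 𝔸ˣ) : 𝔸) - 1‖ ≤ 2 * θ := fun q κ hq =>
    side_estimate V₀ A y R ha hVA L hL q κ (by rw [hRexp]; omega) hθN hθ0 hθ1
  obtain ⟨f1, e1, -, -, -⟩ := hside z μ hzy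
  obtain ⟨f2, e2, -, -, -⟩ := hside (z + (L : ℤ) • e μ) ν hzμy
  obtain ⟨-, -, f3, e3, -⟩ := hside (z + (L : ℤ) • e ν) μ hzνy
  obtain ⟨-, -, f4, e4, -⟩ := hside z ν hzy
  have hP := norm_prod4_sub_one_sub_le (by positivity) f1 f2 f3 f4 e1 e2 e3 e4
  -- (48): the first-order terms add up to `Σ_x L^{−d} A(∂(p′)_x)`
  have hTsum : Tside L A z μ + Tside L A (z + (L : ℤ) • e μ) ν + -Tside L A (z + (L : ℤ) • e ν) μ
      + -Tside L A z ν = ∑ r : Fin d → Fin L, ((L : ℝ) ^ d)⁻¹ • asum A (z + boxVec L r) (rectWord L L μ ν) := by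
    simp only [Tside, ← Finset.sum_neg_distrib, ← Finset.sum_add_distrib, ← smul_neg, ← smul_add]
    refine Finset.sum_congr rfl fun r _ => ?_
    rw [← corner_cancellation]
    congr 1
    abel
  -- (49): the main term, linear form
  have hmain := main_term_linear V₀ A y R ha hVA L hL z μ ν (fun r i j hi hj => by
    have h1 := l1_add_le (z - y) (boxVec L r + (i : ℤ) • e μ + (j : ℤ) • e ν)
    have h2 := (l1_add_le (boxVec L r + (i : ℤ) • e μ) ((j : ℤ) • e ν))
    have h3 := (l1_add_le (boxVec L r) ((i : ℤ) • e μ))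
    have h4 := l1_boxVec_le L r
    rw [l1_zsmul_e, Int.natAbs_natCast] at h2 h3
    rw [show z - y + (boxVec L r + (i : ℤ) • e μ + (j : ℤ) • e ν)
      = z + boxVec L r + (i : ℤ) • e μ + (j : ℤ) • e ν - y by abel] at h1
    rw [hRexp]; omega)
  have hρ : (L : ℝ) ^ 2 * expRem (4 * a) ≤ θ ^ 2 := by
    have h1 : expRem (4 * a) ≤ (4 * a) ^ 2 := expRem_le_sq (by positivity) (by linarith)
    have h2 : θ ^ 2 - (L : ℝ) ^ 2 * (4 * a) ^ 2 = 64 * ((d + 4) * (L : ℝ) ^ 2 * α₀) ^ 2 * ((d + 1) ^ 2 - 4) := by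
      rw [hθdef, hadef]; ring
    have h3 : 0 ≤ 64 * ((d + 4) * (L : ℝ) ^ 2 * α₀) ^ 2 * (((d : ℝ) + 1) ^ 2 - 4) :=
      mul_nonneg (by positivity) (by nlinarith)
    have h4 := mul_le_mul_of_nonneg_left h1 (by positivity : (0 : ℝ) ≤ (L : ℝ) ^ 2)
    linarith
  -- (50): collecting terms
  have hθ3 : θ ^ 3 ≤ θ ^ 2 / 64 := by
    calc θ ^ 3 = θ ^ 2 * θ := by ring
      _ ≤ θ ^ 2 * (1 / 64) := by gcongr
      _ = θ ^ 2 / 64 := by ring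
  have hθ4 : θ ^ 4 ≤ θ ^ 2 / 64 := by
    calc θ ^ 4 = θ ^ 2 * (θ * θ) := by ring
      _ ≤ θ ^ 2 * (1 / 64 * 1) := by gcongr; linarith
      _ = θ ^ 2 / 64 := by ring
  have hcp : ((cplaq L (bavg L V₀) z μ ν : 𝔸ˣ) : 𝔸) = ((bavg L V₀ z μ : 𝔸ˣ) : 𝔸)
      * ((bavg L V₀ (z + (L : ℤ) • e μ) ν : 𝔸ˣ) : 𝔸) * (((bavg L V₀ (z + (L : ℤ) • e ν) μ)⁻¹ : 𝔸ˣ) : 𝔸)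
      * (((bavg L V₀ z ν)⁻¹ : 𝔸ˣ) : 𝔸) := by simp only [cplaq, Units.val_mul]
  rw [hcp]
  rw [hTsum] at hP
  calc _ = ‖(_ - 1 - ∑ r : Fin d → Fin L, ((L : ℝ) ^ d)⁻¹ • asum A (z + boxVec L r) (rectWord L L μ ν))
          + ∑ r : Fin d → Fin L, ((L : ℝ) ^ d)⁻¹ • asum A (z + boxVec L r) (rectWord L L μ ν)‖ := by
          rw [sub_add_cancel]
    _ ≤ _ := norm_add_le _ _
    _ ≤ (4 * (50 * θ ^ 2) + (2 * θ) ^ 2 * (6 + 4 * (2 * θ) + (2 * θ) ^ 2))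
          + (blockFineAvg L V₀ z μ ν + (L : ℝ) ^ 2 * expRem (4 * a)) := add_le_add hP hmain
    _ ≤ blockFineAvg L V₀ z μ ν + 226 * θ ^ 2 := by linarith [sq_nonneg θ]

omit [NormedAlgebra ℂ 𝔸] [CompleteSpace 𝔸] in
/-- (45) for the kept sum: the plaquette deviations of the gauge transform `V^u` are bounded by those of `V`
(`|u V(∂p) u⁻¹ − 1| ≤ |V(∂p) − 1|` for `u ∈ {|u| ≤ 1, |u⁻¹| ≤ 1}`), hence so are the fine sums. [cite: Balaban1985Averaging, (45) p.24] -/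
theorem fineSum_gaugeAct_le {u : Site d → 𝔸ˣ} (hu : ∀ x, u x ∈ U1 𝔸) (V : Site d → Fin d → 𝔸ˣ) (n : ℕ)
    (x : Site d) (μ ν : Fin d) : fineSum n (gaugeAct u V) x μ ν ≤ fineSum n V x μ ν := by
  unfold fineSum
  refine Finset.sum_le_sum fun i _ => Finset.sum_le_sum fun j _ => ?_
  rw [hol_gaugeAct_closed _ _ _ _ (disp_plaqWord μ ν), Units.val_mul, Units.val_mul]
  exact norm_units_conj_sub_one_le (hu _) _

omit [NormedAlgebra ℂ 𝔸] [CompleteSpace 𝔸] in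
/-- `blockFineAvg_gaugeAct_le`: (45) for the block-averaged kept sum. [cite: Balaban1985Averaging, (45) p.24] -/
theorem blockFineAvg_gaugeAct_le {u : Site d → 𝔸ˣ} (hu : ∀ x, u x ∈ U1 𝔸) (V : Site d → Fin d → 𝔸ˣ) (L : ℕ)
    (z : Site d) (μ ν : Fin d) : blockFineAvg L (gaugeAct u V) z μ ν ≤ blockFineAvg L V z μ ν := by
  unfold blockFineAvg
  exact Finset.sum_le_sum fun r _ => mul_le_mul_of_nonneg_left (fineSum_gaugeAct_le hu V L _ μ ν) (by positivity)

/-- **B7 (50), linear form, for an arbitrary configuration — kernel-checked with explicit constants.**  Let `V` be a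
configuration on `ℤ^d` with values in `{u : |u| ≤ 1, |u⁻¹| ≤ 1}` satisfying (44) `|V(∂p) − 1| ≤ α₀` for all unit
plaquettes, and let `512(d+1)(d+4)L²α₀ ≤ 1`.  Then for every plaquette `p′` of the `L`-lattice (lower-left corner
`y₀ = z`, spanned by `e_μ ≠ e_ν`) the average (42) satisfies
`|V̄(∂p′) − 1| ≤ Σ_{x ∈ B(y₀)} L^{−d} Σ_{p ⊂ (p′)_x} |V(∂p) − 1| + C₀(L²α₀)²`, `C₀ = C₀(d) = 226·(8(d+1)(d+4))²` —
print (50): "`|V̄₀(∂p′) − 1| < Σ_{x∈B(y₀)} L^{−d} Σ_{p⊂(p′)_x} |V₀(∂p) − 1| + O(1)(L²α₀)²`" together with (45)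
`|V̄(∂p′) − 1| = |V̄₀(∂p′) − 1|`, `|V₀(∂p) − 1| = |V(∂p) − 1|` (here: `≤`, conjugation by the axial gauge
transformation `v₀` with values in `{|u| ≤ 1, |u⁻¹| ≤ 1}`).  Proof = the printed one: (45) to the axial gauge of B5
(1.7) at `y` (`axialFn`, `axial_bond_bound`), then `prop1_core_linear`. [cite: Balaban1985Averaging, (50) p.25, (45) p.24] -/
theorem prop1_linear (L : ℕ) (hL : 1 ≤ L) (z : Site d) {μ ν : Fin d} (hμν : μ ≠ ν)
    (V : Site d → Fin d → 𝔸ˣ) (hV : ∀ x κ, V x κ ∈ U1 𝔸) {α₀ : ℝ} (hα₀ : 0 ≤ α₀)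
    (hsmall : 512 * (d + 1) * (d + 4) * (L : ℝ) ^ 2 * α₀ ≤ 1)
    (h44 : ∀ (x : Site d) (κ κ' : Fin d), κ ≠ κ' → ‖((hol V x (plaqWord κ κ') : 𝔸ˣ) : 𝔸) - 1‖ ≤ α₀) :
    ‖((cplaq L (bavg L V) z μ ν : 𝔸ˣ) : 𝔸) - 1‖ ≤ blockFineAvg L V z μ ν + C0 d * ((L : ℝ) ^ 2 * α₀) ^ 2 := by
  set y : Site d := z + (L : ℤ) • e μ + (L : ℤ) • e ν with hy
  set u : Site d → 𝔸ˣ := axialFn V y with hu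
  set V₀ : Site d → Fin d → 𝔸ˣ := gaugeAct u V with hV₀
  have huU : ∀ x, u x ∈ U1 𝔸 := fun x => axialFn_mem hV y x
  have h44₀ : ∀ x, ‖((hol V₀ x (plaqWord μ ν) : 𝔸ˣ) : 𝔸) - 1‖ ≤ α₀ := fun x => by
    rw [hV₀, hol_gaugeAct_closed _ _ _ _ (disp_plaqWord μ ν), Units.val_mul, Units.val_mul]
    exact (norm_units_conj_sub_one_le (huU x) _).trans (h44 x μ ν hμν)
  have hbond : ∀ x κ, l1 (x - y) ≤ (2 * d + 4) * L + 4 → ‖((V₀ x κ : 𝔸ˣ) : 𝔸) - 1‖ ≤ l1 (x - y) * α₀ :=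
    fun x κ _ => axial_bond_bound V hV y h44 hα₀ x κ
  have hcore := prop1_core_linear L hL z y hy V₀ hα₀ hsmall hbond
  obtain ⟨-, hW⟩ := prop1_core L hL z y hy V₀ hα₀ hsmall h44₀ hbond
  -- (45): `V̄₀_c = u(c₋) V̄_c u(c₊)⁻¹` on the four sides, hence `V̄₀(∂p′) = u(z) V̄(∂p′) u(z)⁻¹`
  have hzy : l1 (z - y) ≤ 2 * L := by
    rw [hy, show z - (z + (L : ℤ) • e μ + (L : ℤ) • e ν) = -((L : ℤ) • e μ + (L : ℤ) • e ν) by abel, l1_neg]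
    refine (l1_add_le _ _).trans ?_
    rw [l1_zsmul_e, l1_zsmul_e, Int.natAbs_natCast]; omega
  have hzμy : l1 (z + (L : ℤ) • e μ - y) ≤ 2 * L := by
    rw [hy, show z + (L : ℤ) • e μ - (z + (L : ℤ) • e μ + (L : ℤ) • e ν) = -((L : ℤ) • e ν) by abel, l1_neg,
      l1_zsmul_e, Int.natAbs_natCast]; omega
  have hzνy : l1 (z + (L : ℤ) • e ν - y) ≤ 2 * L := by
    rw [hy, show z + (L : ℤ) • e ν - (z + (L : ℤ) • e μ + (L : ℤ) • e ν) = -((L : ℤ) • e μ) by abel, l1_neg,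
      l1_zsmul_e, Int.natAbs_natCast]; omega
  have hcov : ∀ q κ, l1 (q - y) ≤ 2 * L → bavg L V₀ q κ = u q * bavg L V q κ * (u (q + (L : ℤ) • e κ))⁻¹ := by
    intro q κ hq
    rw [hV₀]
    refine bavg_gaugeAct L huU V q κ fun r => ?_
    refine (norm_sub_one_le_of_conj (X := Wcx L V q κ (boxVec L r)) (huU q)).trans_lt ?_
    rw [← Wcx_gaugeAct]
    exact hW q κ hq r
  have hconj := cplaq_conj L u (bavg L V) (bavg L V₀) z μ ν (hcov z μ hzy) (hcov _ ν hzμy) (hcov _ μ hzνy)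
    (hcov z ν hzy)
  have hC : C0 d * ((L : ℝ) ^ 2 * α₀) ^ 2 = 226 * (8 * (d + 1) * (d + 4) * (L : ℝ) ^ 2 * α₀) ^ 2 := by
    unfold C0; ring
  refine (norm_sub_one_le_of_conj (X := cplaq L (bavg L V) z μ ν) (huU z)).trans ?_
  rw [← hconj, hC]
  refine hcore.trans (add_le_add ?_ le_rfl)
  rw [hV₀]
  exact blockFineAvg_gaugeAct_le huU V L z μ ν

end Linear

/-! ## §3 (53)/(54) at an intermediate level of the `k`-fold average (43) -/

section Levels

variable {𝔸 : Type*} [NormedRing 𝔸] [NormOneClass 𝔸] [NormedAlgebra ℂ 𝔸] [CompleteSpace 𝔸]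

/-- **(53)/(54) of [4] at an intermediate level:** under (52)/(68) `sup_p |U(∂p) − 1| < α₀η²`, `η = L^{−j}`, and the
Prop.-2 smallness, every `Ū^i`, `i ≤ j`, satisfies `sup_p |Ū^i(∂p) − 1| < 2α₀(L^iη)²` — Proposition 2 (54)
(`prop2_explicit_at_lt_two`) applied with `k := i` and the constant `α₀(L^iη)² ≤ α₀` (print p. 26: (53) "can be
bounded by `α₀ + C₀α₀²2` … `< 2α₀`", with the factor `L^{2i}η²` kept). [cite: Balaban1985Averaging, (53)–(54) p.26] -/
theorem pdev_avgIter_lt_level (L : ℕ) (hL : 2 ≤ L) {G : Subgroup 𝔸ˣ} {t : ℝ} (hG : AvgClosedAt d t L G) (j : ℕ)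
    (V : Site d → Fin d → 𝔸ˣ) (hV : ∀ x κ, V x κ ∈ G) {α₀ : ℝ} (hα : 0 < α₀)
    (hα3 : C0 d * α₀ ≤ 1 / 3) (hα2 : 2 * α₀ ≤ c2' d L)
    (hαt : 32 * ((d : ℝ) + 1) * (d + 4) * (L : ℝ) ^ 2 * α₀ ≤ t)
    (h52 : pdev V < α₀ * (((L : ℝ) ^ j)⁻¹) ^ 2) (i : ℕ) (hi : i ≤ j) :
    pdev (avgIter L V i) < 2 * (α₀ * ((L : ℝ) ^ i * ((L : ℝ) ^ j)⁻¹) ^ 2) := by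
  have hLr : (2 : ℝ) ≤ L := by exact_mod_cast hL
  have hL1r : (1 : ℝ) ≤ L := by linarith
  have hLpos : (0 : ℝ) < L := by linarith
  have hC := C0_pos d
  set α' : ℝ := α₀ * ((L : ℝ) ^ i * ((L : ℝ) ^ j)⁻¹) ^ 2 with hα'
  have hratio : ((L : ℝ) ^ i * ((L : ℝ) ^ j)⁻¹) ^ 2 ≤ 1 := by
    have h1 : (L : ℝ) ^ i * ((L : ℝ) ^ j)⁻¹ ≤ 1 := by
      rw [← div_eq_mul_inv, div_le_one (by positivity)]
      exact pow_le_pow_right₀ hL1r hi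
    exact pow_le_one₀ (by positivity) h1
  have hα'0 : 0 < α' := by positivity
  have hα'le : α' ≤ α₀ := mul_le_of_le_one_right hα.le hratio
  have hα'3 : C0 d * α' ≤ 1 / 3 := (mul_le_mul_of_nonneg_left hα'le hC.le).trans hα3
  have hα'2 : 2 * α' ≤ c2' d L := by linarith
  have hα't : 32 * ((d : ℝ) + 1) * (d + 4) * (L : ℝ) ^ 2 * α' ≤ t := by
    have h0 : (0 : ℝ) ≤ 32 * ((d : ℝ) + 1) * (d + 4) * (L : ℝ) ^ 2 := by positivity
    exact (mul_le_mul_of_nonneg_left hα'le h0).trans hαt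
  have h52' : pdev V < α' * (((L : ℝ) ^ i)⁻¹) ^ 2 := by
    have hLi : (L : ℝ) ^ i ≠ 0 := by positivity
    have hLj : (L : ℝ) ^ j ≠ 0 := by positivity
    have : α' * (((L : ℝ) ^ i)⁻¹) ^ 2 = α₀ * (((L : ℝ) ^ j)⁻¹) ^ 2 := by
      rw [hα']; field_simp
    rw [this]; exact h52
  exact prop2_explicit_at_lt_two L hL hG i V hV hα'0 hα'3 hα'2 hα't h52'

end Levels

end Literature.MathematicalPhysics.QuantumFieldTheory.Balaban1983to89.B7Eq50Linear
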